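import Mathlib.RingTheory.Regular.RegularSequence
import Mathlib.RingTheory.Localization.AtPrime.Basic
import Mathlib.RingTheory.Ideal.Height
import Mathlib.RingTheory.Ideal.MinimalPrime.Basic
import Mathlib.Algebra.CharP.Lemmas
import Literature.RingTheory.TightClosure.TightClosure
import Summits.ResolutionOfSingularities.ResolutionOfSingularities.Theorems.FrobeniusLadderFInjectiveMacaulayficationSopThroughPrime
import Summits.ResolutionOfSingularities.ResolutionOfSingularities.Theorems.FrobeniusLadderFInjectiveMacaulayficationCmLocalizes
import Summits.ResolutionOfSingularities.ResolutionOfSingularities.Theorems.FrobeniusLadderFInjectiveMacaulayficationFrobeniusClosedLocalizes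
import HarnessLib

/-!
# The Cohen–Macaulay + F-injective clause localizes

Support file for crux stmt-ResolutionOfSingularities-15315 (`FrobeniusLadder.FInjectiveMacaulayfication`,
line `Sketch`, lead seat c3, cycle 4, wave 2). It assembles the wave-2 helper stubs
(`SopThroughPrime.stub_sopThroughPrime` p134539, `CmLocalizes.stub_cmLocalizes` p134453,
`FrobeniusClosedLocalizes.stub_frobeniusClosedLocalizes` p134577) into ENGINE E5 of the line's certification
toolbox: **the crux's per-stalk clause LOCALIZES** — if a Noetherian local ring `R` of prime characteristic
`p` has every system of parameters weakly regular with Frobenius closed ideal (Cohen–Macaulay + F-injective,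
Quy–Shimomoto), then so does `R_P` for every prime `P` (`clause_localization`; with the domain conjunct,
`fiClause_localization`). Ideal-theoretic proof, no local cohomology (the printed route, Datta–Murayama, goes
through the Frobenius action on `H^i_𝔪`): `P` is minimal over the head `x ⊆ P` of a system of parameters
(prime avoidance); `x` is `R`-regular hence `R_P`-regular of length `ht P = dim R_P`, so `R_P` is
Cohen–Macaulay (`SopWeaklyRegular`); `(x)` is Frobenius closed in `R` (`PartialSop`), hence `(x)R_P` is
(`c·yᵠ ∈ (x)^[q]`, `c ∉ P` ⇒ `(cy)ᵠ ∈ (x)^[q]` ⇒ `cy ∈ (x)`), and one Frobenius closed parameter ideal of a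
Cohen–Macaulay local ring makes all of them so (`OneSop`, p131741).

Why the line needs it: every certification engine (E2 Fedder at a closed point, E1 deformation, E4 degree-zero
descent) delivers the clause at ONE local ring, in practice at closed points, while the crux quantifies over all
points of `X'`; the scheme-level glue (stalks at generizations are localizations of stalks, Jacobson schemes)
is the sequel `…ClauseLocalizesScheme.lean` (`fiClause_of_closedPoints`).

References: [QuyShimomoto2017] P. H. Quy, K. Shimomoto, Adv. Math. 313 (2017) §3; R. Datta, T. Murayama,
"Permanence properties of F-injectivity" (2020) Prop. 3.3; [Matsumura1987] Thm 17.3 (iii).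
-/

-- single-problem summit: the doubled namespace component is forced
set_option linter.dupNamespace false

namespace Summit.ResolutionOfSingularities.ResolutionOfSingularities.Theorems.FInjectiveMacaulayfication.ClauseLocalizes

open IsLocalRing RingTheory.Sequence Literature.RingTheory.TightClosure

variable (p : ℕ) [Fact p.Prime]

/-- Inline form of the clause ⇒ `IsSystemOfParameters`/`IsFrobeniusClosed` form. [folklore] -/
private theorem sopClause_of_inline {L : Type} [CommRing L] [IsLocalRing L] [CharP L p]
    (h : ∀ d : ℕ, ringKrullDim L = d → ∀ s : Fin d → L, (Ideal.span (Set.range s)).radical.IsMaximal →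
      IsWeaklyRegular L (List.ofFn s) ∧
      ∀ y : L, (∃ e : ℕ, y ^ p ^ e ∈ Ideal.span ((fun z : L => z ^ p ^ e) ''
        (Ideal.span (Set.range s) : Set L))) → y ∈ Ideal.span (Set.range s)) :
    ∀ ⦃n : ℕ⦄ (u : Fin n → L), IsSystemOfParameters u →
      IsWeaklyRegular L (List.ofFn u) ∧ IsFrobeniusClosed p (Ideal.span (Set.range u)) := by
  intro n u hu
  obtain ⟨hd, hrad⟩ := (isSystemOfParameters_iff).mp hu
  obtain ⟨hW, hF⟩ := h n hd u hrad
  exact ⟨hW, (isFrobeniusClosed_iff p).mpr hF⟩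

/-- **THE CLAUSE LOCALIZES.** If a Noetherian local ring `R` of prime characteristic `p` satisfies the crux's
per-stalk clause (every system of parameters is weakly regular and generates a Frobenius closed ideal — i.e.
`R` is Cohen–Macaulay and F-injective, Quy–Shimomoto), then so does its localization `R_P` at every prime
`P`. Ideal-theoretic proof (no local cohomology): `P` is minimal over the head `x ⊆ P` of a system of
parameters (`stub_sopThroughPrime`); `x` is `R`-regular hence `R_P`-regular of length `ht P = dim R_P`, so
`R_P` is Cohen–Macaulay (`stub_cmLocalizes`); `(x)` is Frobenius closed in `R`, hence `(x)R_P` is, and one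
Frobenius closed parameter ideal of the Cohen–Macaulay ring `R_P` makes all of them so
(`stub_frobeniusClosedLocalizes`). This is what turns a certification of the clause at the CLOSED points of a
modification (Fedder's criterion E2, deformation E1, degree-zero descent) into the crux's clause at ALL points.
[folklore; cf. DattaMurayama2020 Prop 3.3 (F-injectivity localizes), Matsumura1987 Thm 17.3 (iii)] -/
theorem clause_localization {R : Type} [CommRing R] [IsNoetherianRing R] [IsLocalRing R] [CharP R p]
    (hR : ∀ d : ℕ, ringKrullDim R = d → ∀ s : Fin d → R, (Ideal.span (Set.range s)).radical.IsMaximal →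
      IsWeaklyRegular R (List.ofFn s) ∧
      ∀ y : R, (∃ e : ℕ, y ^ p ^ e ∈ Ideal.span ((fun z : R => z ^ p ^ e) ''
        (Ideal.span (Set.range s) : Set R))) → y ∈ Ideal.span (Set.range s))
    (P : Ideal R) [P.IsPrime] :
    ∀ d : ℕ, ringKrullDim (Localization.AtPrime P) = d → ∀ s : Fin d → Localization.AtPrime P,
      (Ideal.span (Set.range s)).radical.IsMaximal →
      IsWeaklyRegular (Localization.AtPrime P) (List.ofFn s) ∧
      ∀ y : Localization.AtPrime P, (∃ e : ℕ, y ^ p ^ e ∈ Ideal.span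
        ((fun z : Localization.AtPrime P => z ^ p ^ e) ''
          (Ideal.span (Set.range s) : Set (Localization.AtPrime P)))) → y ∈ Ideal.span (Set.range s) := by
  have hsop := sopClause_of_inline p hR
  have hCM : ∀ ⦃n : ℕ⦄ (u : Fin n → R), IsSystemOfParameters u → IsWeaklyRegular R (List.ofFn u) :=
    fun n u hu => (hsop u hu).1
  obtain ⟨h, e, x, t, hxt, hxP, hmin, hht⟩ := SopThroughPrime.stub_sopThroughPrime R P
  have hCMP := CmLocalizes.stub_cmLocalizes R hCM P h e x t hxt hxP hmin hht
  have hFCP := FrobeniusClosedLocalizes.stub_frobeniusClosedLocalizes p R hsop P h e x t hxt hxP hmin hht hCMP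
  intro n hn u hrad
  have hu : IsSystemOfParameters u := isSystemOfParameters_iff.mpr ⟨hn, hrad⟩
  exact ⟨hCMP u hu, hFCP u hu⟩

/-- **The full stalk clause (with the domain conjunct) localizes**: verbatim the per-stalk predicate of
`FrobeniusLadder.FInjectiveMacaulayfication` passes from a Noetherian local ring of characteristic `p` to its
localizations at primes. [folklore] -/
theorem fiClause_localization {R : Type} [CommRing R] [IsNoetherianRing R] [IsLocalRing R] [CharP R p]
    (hR : IsDomain R ∧ ∀ d : ℕ, ringKrullDim R = d → ∀ s : Fin d → R,
      (Ideal.span (Set.range s)).radical.IsMaximal →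
      IsWeaklyRegular R (List.ofFn s) ∧
      ∀ y : R, (∃ e : ℕ, y ^ p ^ e ∈ Ideal.span ((fun z : R => z ^ p ^ e) ''
        (Ideal.span (Set.range s) : Set R))) → y ∈ Ideal.span (Set.range s))
    (P : Ideal R) [P.IsPrime] :
    IsDomain (Localization.AtPrime P) ∧
    ∀ d : ℕ, ringKrullDim (Localization.AtPrime P) = d → ∀ s : Fin d → Localization.AtPrime P,
      (Ideal.span (Set.range s)).radical.IsMaximal →
      IsWeaklyRegular (Localization.AtPrime P) (List.ofFn s) ∧
      ∀ y : Localization.AtPrime P, (∃ e : ℕ, y ^ p ^ e ∈ Ideal.span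
        ((fun z : Localization.AtPrime P => z ^ p ^ e) ''
          (Ideal.span (Set.range s) : Set (Localization.AtPrime P)))) → y ∈ Ideal.span (Set.range s) := by
  haveI := hR.1
  exact ⟨IsLocalization.isDomain_localization P.primeCompl_le_nonZeroDivisors,
    clause_localization p hR.2 P⟩

/-! ## Registered form -/

/-- **E5, registered helper-stub form** (fully explicit binders; = `clause_localization`): the Cohen–Macaulay +
F-injective clause passes from a Noetherian local ring of characteristic `p` to its localization at any prime.
[folklore; cf. DattaMurayama2020 Prop 3.3] -/
theorem stub_clauseLocalizes : ∀ (p : ℕ) [Fact p.Prime] (R : Type) [CommRing R] [IsNoetherianRing R] [IsLocalRing R]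
    [CharP R p], (∀ d : ℕ, ringKrullDim R = d → ∀ s : Fin d → R, (Ideal.span (Set.range s)).radical.IsMaximal →
      RingTheory.Sequence.IsWeaklyRegular R (List.ofFn s) ∧
      ∀ y : R, (∃ e : ℕ, y ^ p ^ e ∈ Ideal.span ((fun z : R => z ^ p ^ e) ''
        (Ideal.span (Set.range s) : Set R))) → y ∈ Ideal.span (Set.range s)) →
    ∀ (P : Ideal R) [P.IsPrime],
    ∀ d : ℕ, ringKrullDim (Localization.AtPrime P) = d → ∀ s : Fin d → Localization.AtPrime P,
      (Ideal.span (Set.range s)).radical.IsMaximal →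
      RingTheory.Sequence.IsWeaklyRegular (Localization.AtPrime P) (List.ofFn s) ∧
      ∀ y : Localization.AtPrime P, (∃ e : ℕ, y ^ p ^ e ∈ Ideal.span
        ((fun z : Localization.AtPrime P => z ^ p ^ e) ''
          (Ideal.span (Set.range s) : Set (Localization.AtPrime P)))) → y ∈ Ideal.span (Set.range s) :=
  fun p _ _ _ _ _ _ hR P _ => clause_localization p hR P

end Summit.ResolutionOfSingularities.ResolutionOfSingularities.Theorems.FInjectiveMacaulayfication.ClauseLocalizes
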